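import Summits.NavierStokesRegularity.NavierStokesRegularity.Theorems.FilamentSkeletonRssDefectColumnGateDefs

/-!
# Route `FilamentSkeletonRss` · crux `TransverseReduction1AL` (stmt-NavierStokesRegularity-23297, Variant A1L — rigid matched cores) —
# line of record `defect_column_gate_1AL`: the line's VOCABULARY re-pointed at the L-twin (ONE conjunct swapped)

Definitions (+ one `Iff.rfl` certificate), `--supports stmt-NavierStokesRegularity-23297 --as helper`; LEAD of 23297 (= the L-twin of the aside 27853),
lane ns-filament-21221-p1 g11, on tenure g23's ask (d) «re-register defect_column_gate v4 ceb3508ea1397354 as v5 on 23297: Defs `Clauses1G` → `Clauses1L`,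
ONE conjunct».  THE ONE SWAP (route revs 44–47, ns-idea-12 kit 66aa737d78a81db5): in the clause block the passive core-area law
`w·Aa′ = (3/2 − w′)Aa + 4` is replaced by the rigid matched core `1 ≤ KA·Aa j (c j) ∧ (‖X j τ‖ ≤ 2Rb√(Γ log Γ) → Aa j τ = Aa j (c j))`; every other clause,
the defining hypotheses `DefU1 … DefT1`, the conclusion `Concl1`, the family / gate specs `FamilySpec1AG` / `DefectGateSpec1AG`, `AlmostConcl1AG`,
`DefectContinuity1AG` (S3b, clause-free) and the whole waist-column model (`colBase`, `colForceVort`, `WaistColumnGateLoc1A` = S2a-loc, clause-free) are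
REUSED from `Theorems/FilamentSkeletonRssDefectColumnGateDefs.lean` unchanged.  Contents: `Clauses1L`; `CutForm1AL` + `transverseReduction1AL_iff :
TransverseReduction1AL ↔ CutForm1AL := Iff.rfl`; the stub statements `RateSelection1AL` (S0), `DefectFamily1AL` / `FamilyDressing1AL` (S1), `DefectGate1AL`,
`GateAssemblyLoc1AL` (S2b-loc), `DefectClosing1AL` (S3), `ClosingIVT1AL := DefectContinuity1AG → DefectClosing1AL` (S3a) — each the 1AG text with `Clauses1G`
replaced by `Clauses1L`, nothing else.  All statements are `def … : Prop` and are NEVER asserted here.  HONEST FRAMING: bookkeeping for a HYPOTHETICAL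
filament-type rotating-self-similar blow-up route (MODEL rung, negative side); nothing here bears on Navier–Stokes regularity; `TransverseReduction1AL` is
neither proved nor refuted.
-/

set_option linter.dupNamespace false

noncomputable section

namespace Summit.NavierStokesRegularity.NavierStokesRegularity.Theorems.DefectColumnGate

open scoped BigOperators Topology Manifold Classical MeasureTheory ProbabilityTheory Matrix InnerProductSpace ComplexConjugate ContinuousMap ENNReal ContDiff
open Filter Set Function TopologicalSpace MeasureTheory
open Literature.NS
open Literature.Analysis.FluidPDE
open Summit.NavierStokesRegularity.NavierStokesRegularity.Theses.FilamentSkeletonRss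
open Summit.NavierStokesRegularity.NavierStokesRegularity.Theorems.KelvinGate (lerayOp lerayLin XBound YBound LocClose)

/-! ## 1. The L-twin of the crux, cut at its arrows -/

/-- The `SkeletonJ1L` clause block of the crux's hypothesis: `Clauses1G` with ONE conjunct swapped (Variant A1L, rigid matched cores:
the passive core-area law is replaced by `1 ≤ KA·Aa j (c j) ∧ (‖X j τ‖ ≤ 2Rb√(Γ log Γ) → Aa j τ = Aa j (c j))`; all other clauses VERBATIM). -/
def Clauses1L (N : ℕ) (Γ δ ρ K Λ a b cnd Rw Rb cg θ₀ KA : ℝ) (γ : Fin N → ℝ) (α : ℝ) (X : Fin N → ℝ → EuclideanSpace ℝ (Fin 3)) (w : Fin N → ℝ → ℝ) (c : Fin N → ℝ) (m n : Fin N → EuclideanSpace ℝ (Fin 3)) (Aa : Fin N → ℝ → ℝ) (v : EuclideanSpace ℝ (Fin 3) → EuclideanSpace ℝ (Fin 3)) (A : Fin N → (EuclideanSpace ℝ (Fin 3) →L[ℝ] EuclideanSpace ℝ (Fin 3))) (T : (Fin N → ℝ → EuclideanSpace ℝ (Fin 3)) → Fin N → ℝ → EuclideanSpace ℝ (Fin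 3)) : Prop :=
  (α ≠ 0 ∧ (∀ j, γ j ≠ 0)∧(∀ j, ContDiff ℝ 2 (X j) ∧ Differentiable ℝ (w j)∧(∀ τ, ‖deriv (X j) τ‖ = 1)∧(∀ τ, ‖iteratedDeriv 2 (X j) τ‖*√Γ≤K) ∧ Tendsto (fun τ => ‖X j τ‖) (cocompact ℝ) atTop)∧(∀ j k, j ≠ k → ∀ τ σ, ρ*√Γ≤‖X j τ-X k σ‖)∧(∀ j τ σ, ρ*√Γ≤|τ-σ| → cg*ρ*√Γ≤‖X j τ-X j σ‖)∧(∀ j τ, cg*|τ-c j|≤Rw*√Γ+‖X j τ‖)∧(∀ j τ, w j τ = ⟪v (X j τ), deriv (X j) τ⟫_ℝ)∧(∀ j τ, ‖X j τ‖≤Rb*√(Γ*Real.log Γ) → v (X j τ) = w j τ•deriv (X j) τ)∧(∀ j, ‖X j (c j)‖≤Rw*√Γ)∧(∀ j, |⟪deriv (X j) (c j), EuclideanSpace.single 2 1⟫_ℝ|≤1-θ₀)∧(θ₀≤|α| ∧ |α|≤θ₀⁻¹ ∧ ∀ j, θ₀≤|γ j| ∧ |γ j|≤θ₀⁻¹)∧(∀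 j, w j (c j) = 0 ∧ (∀ τ, w j τ = 0 → τ = c j) ∧ 3/2+δ≤deriv (w j) (c j) ∧ deriv (w j) (c j)≤Λ)∧(∀ j, Differentiable ℝ (Aa j) ∧ (∀ τ, 0 < Aa j τ) ∧ 1≤KA*Aa j (c j) ∧ ∀ τ, ‖X j τ‖≤2*Rb*√(Γ*Real.log Γ) → Aa j τ = Aa j (c j))∧(∀ j τ, Rw^2*Γ*Aa j τ≤KA*(Rw^2*Γ+‖X j τ‖^2))∧(∀ j, Orthonormal ℝ ![deriv (X j) (c j), m j, n j] ∧ ⟪A j (m j), m j⟫_ℝ+⟪A j (n j), n j⟫_ℝ < 0 ∧ ⟪A j (n j), m j⟫_ℝ * ⟪A j (m j), n j⟫_ℝ < ⟪A j (m j), m j⟫_ℝ * ⟪A j (n j), n j⟫_ℝ)∧(∀ Y:Fin N → ℝ → EuclideanSpace ℝ (Fin 3), (∀ j, ContDiff ℝ 2 (Y j))→(∀ j τ, ⟪Y j τ, deriv (X j) τ⟫_ℝ = 0) → (∀ j τ, Rb*√(Γ*Real.log Γ) < ‖X j τ‖ → Y j τ = 0) → ∑ j, ⟪Y j (c j), cross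 (EuclideanSpace.single 2 1) (X j (c j))⟫_ℝ = 0 → (∀ j τ, ‖Y j τ‖+‖deriv (Y j) τ‖+‖iteratedDeriv 2 (Y j) τ‖≤(1+|τ-c j|)^b) → ∀ L:ℝ, (∀ j τ, ‖deriv (fun s:ℝ => T (fun k σ => X k σ+s•Y k σ) j τ) 0‖≤L*(1+|τ-c j|)^a) → ∀ j τ, ‖Y j τ‖≤cnd*L*(1+|τ-c j|)^b))

/-- The CUT FORM of the crux: hypotheses `DefU1 … Clauses1L`, conclusion `Concl1` (an `abbrev`, so that the line's glue theorem
concludes THIS constant and only `TransverseReduction1AL_of` below concludes the crux by name — skeleton A12 shape). -/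
abbrev CutForm1AL : Prop :=
    ∀ (N : ℕ) (δ ρ K Λ a b cnd η Rw Rb cg θ₀ KA : ℝ), 0 < N → 0 < δ → 0 < ρ → 0 ≤ a → 0 < η → 0 < Rw → 0 < Rb → 0 < cg → 0 < θ₀ → ∃ Γ₁ : ℝ, ∀ Γ : ℝ, Γ₁ ≤ Γ → ∀ (γ : Fin N → ℝ) (α : ℝ) (X : Fin N → ℝ → EuclideanSpace ℝ (Fin 3)) (w : Fin N → ℝ → ℝ) (c : Fin N → ℝ) (m n : Fin N → EuclideanSpace ℝ (Fin 3)) (Aa : Fin N → ℝ → ℝ) (u : (Fin N → ℝ → EuclideanSpace ℝ (Fin 3)) → EuclideanSpace ℝ (Fin 3) → EuclideanSpace ℝ (Fin 3)) (v : EuclideanSpace ℝ (Fin 3) → EuclideanSpace ℝ (Fin 3)) (A : Fin N → (EuclideanSpace ℝ (Fin 3) →L[ℝ] EuclideanSpace ℝ (Fin 3))) (T : (Fin N → ℝ → EuclideanSpace ℝ (Fin 3)) → Fin N → ℝ → EuclideanSpace ℝ (Fin 3)),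
      DefU1 N Γ γ Aa u → DefV1 N α X u v → DefA1 N X c v A → DefT1 N α u T → Clauses1L N Γ δ ρ K Λ a b cnd Rw Rb cg θ₀ KA γ α X w c m n Aa v A T → ∃ (α₁ C₀ M : ℝ) (U : EuclideanSpace ℝ (Fin 3) → EuclideanSpace ℝ (Fin 3)) (P : EuclideanSpace ℝ (Fin 3) → ℝ), Concl1 N Γ ρ η Rw X u α₁ C₀ M U P

/-- CERTIFICATE that §1 is the crux: the route decl `TransverseReduction1AL` unfolds to the cut form by `Iff.rfl`. -/
theorem transverseReduction1AL_iff : TransverseReduction1AL ↔ CutForm1AL :=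
  Iff.rfl

/-! ## 2. The statements of the line, re-pointed (S2a-loc `WaistColumnGateLoc1A` and S3b `DefectContinuity1AG` are clause-free and reused) -/

/-- **Statement of stub S0 · `RateSelection1AL` (size M–L; KILL-FIRST #1; skeleton level, MODEL-checkable).**  FIRST-ORDER RATE
SELECTION with polynomial loss: for every admissible skeleton, the conditional a-priori bound of clause 13-J continues to hold
when the linearised in-ball filament-equilibrium map is AUGMENTED by the rate column `dα ↦ −dα·P_n(e₃ × X_j(τ))` (the
`α`-derivative of `T` at the skeleton; `P_n` = projection off the unit tangent) and the defect is measured IN THE BALL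
`‖X j τ‖ ≤ Rb√(Γ log Γ)` only: phase-orthogonal ball-supported normal variations `Y` AND the rate increment `dα` are both controlled,
`‖Y j τ‖ ≤ cR Γ^q · L · (1+|τ−c j|)^b` and `|dα|·√Γ ≤ cR Γ^q · L`.  Equivalently: the in-ball rate column is polynomially
transversal to the range of the phase-orthogonal linearised skeleton operator — the skeleton-level form of `⟨ψ*, 𝓡U⟩ ≠ 0`.
`q, cR` depend on the box constants only. -/
def RateSelection1AL : Prop :=
  ∀ (N : ℕ) (δ ρ K Λ a b cnd η Rw Rb cg θ₀ KA : ℝ), 0 < N → 0 < δ → 0 < ρ → 0 ≤ a → 0 < η → 0 < Rw → 0 < Rb → 0 < cg → 0 < θ₀ →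
    ∃ q cR Γ₁ : ℝ, 0 < cR ∧ ∀ Γ : ℝ, Γ₁ ≤ Γ → ∀ (γ : Fin N → ℝ) (α : ℝ) (X : Fin N → ℝ → EuclideanSpace ℝ (Fin 3)) (w : Fin N → ℝ → ℝ) (c : Fin N → ℝ) (m n : Fin N → EuclideanSpace ℝ (Fin 3)) (Aa : Fin N → ℝ → ℝ) (u : (Fin N → ℝ → EuclideanSpace ℝ (Fin 3)) → EuclideanSpace ℝ (Fin 3) → EuclideanSpace ℝ (Fin 3)) (v : EuclideanSpace ℝ (Fin 3) → EuclideanSpace ℝ (Fin 3)) (A : Fin N → (EuclideanSpace ℝ (Fin 3) →L[ℝ] EuclideanSpace ℝ (Fin 3))) (T : (Fin N → ℝ → EuclideanSpace ℝ (Fin 3)) → Fin N → ℝ → EuclideanSpace ℝ (Fin 3)),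
      DefU1 N Γ γ Aa u → DefV1 N α X u v → DefA1 N X c v A → DefT1 N α u T → Clauses1L N Γ δ ρ K Λ a b cnd Rw Rb cg θ₀ KA γ α X w c m n Aa v A T →
      ∀ Y : Fin N → ℝ → EuclideanSpace ℝ (Fin 3), (∀ j, ContDiff ℝ 2 (Y j)) → (∀ j τ, ⟪Y j τ, deriv (X j) τ⟫_ℝ = 0) →
        (∀ j τ, Rb * √(Γ * Real.log Γ) < ‖X j τ‖ → Y j τ = 0) →
        ∑ j, ⟪Y j (c j), cross (EuclideanSpace.single 2 1) (X j (c j))⟫_ℝ = 0 →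
        (∀ j τ, ‖Y j τ‖ + ‖deriv (Y j) τ‖ + ‖iteratedDeriv 2 (Y j) τ‖ ≤ (1 + |τ - c j|) ^ b) →
        ∀ dα L : ℝ,
          (∀ j τ, ‖X j τ‖ ≤ Rb * √(Γ * Real.log Γ) →
            ‖deriv (fun s : ℝ => T (fun k σ => X k σ + s • Y k σ) j τ) 0
                - dα • (cross (EuclideanSpace.single 2 1) (X j τ)
                        - ⟪cross (EuclideanSpace.single 2 1) (X j τ), deriv (X j) τ⟫_ℝ • deriv (X j) τ)‖
              ≤ L * (1 + |τ - c j|) ^ a) →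
          (∀ j τ, ‖Y j τ‖ ≤ cR * Γ ^ q * L * (1 + |τ - c j|) ^ b) ∧ |dα| * √Γ ≤ cR * Γ ^ q * L

/-- **Conclusion of stub S1** — existence of the re-wound defect family (spec `FamilySpec1AG`) for EVERY requested window exponent
`q₁` and order `k`, with size constant `Cs` uniform in both; residual constant `Cr` and threshold `Γ₁` may depend on `q₁, k`. -/
def DefectFamily1AL : Prop :=
  ∀ (N : ℕ) (δ ρ K Λ a b cnd η Rw Rb cg θ₀ KA : ℝ), 0 < N → 0 < δ → 0 < ρ → 0 ≤ a → 0 < η → 0 < Rw → 0 < Rb → 0 < cg → 0 < θ₀ →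
    ∃ Cs : ℝ, ∀ (q₁ : ℝ) (k : ℕ), ∃ Cr Γ₁ : ℝ, ∀ Γ : ℝ, Γ₁ ≤ Γ → ∀ (γ : Fin N → ℝ) (α : ℝ) (X : Fin N → ℝ → EuclideanSpace ℝ (Fin 3)) (w : Fin N → ℝ → ℝ) (c : Fin N → ℝ) (m n : Fin N → EuclideanSpace ℝ (Fin 3)) (Aa : Fin N → ℝ → ℝ) (u : (Fin N → ℝ → EuclideanSpace ℝ (Fin 3)) → EuclideanSpace ℝ (Fin 3) → EuclideanSpace ℝ (Fin 3)) (v : EuclideanSpace ℝ (Fin 3) → EuclideanSpace ℝ (Fin 3)) (A : Fin N → (EuclideanSpace ℝ (Fin 3) →L[ℝ] EuclideanSpace ℝ (Fin 3))) (T : (Fin N → ℝ → EuclideanSpace ℝ (Fin 3)) → Fin N → ℝ → EuclideanSpace ℝ (Fin 3)),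
      DefU1 N Γ γ Aa u → DefV1 N α X u v → DefA1 N X c v A → DefT1 N α u T → Clauses1L N Γ δ ρ K Λ a b cnd Rw Rb cg θ₀ KA γ α X w c m n Aa v A T →
      ∃ (α0 β₀ : ℝ) (U0 : ℝ → EuclideanSpace ℝ (Fin 3) → EuclideanSpace ℝ (Fin 3)) (P0 : ℝ → EuclideanSpace ℝ (Fin 3) → ℝ) (Z : ℝ → EuclideanSpace ℝ (Fin 3) → EuclideanSpace ℝ (Fin 3)) (g : ℝ → ℝ) (r : ℝ → EuclideanSpace ℝ (Fin 3) → EuclideanSpace ℝ (Fin 3)),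
        FamilySpec1AG N Γ ρ η Rw Rb θ₀ k Cs Cr q₁ α X u α0 β₀ U0 P0 Z g r

/-- **Statement of stub S1 · `FamilyDressing1AL` (size XL; matched asymptotics to every order with ORDER-BY-ORDER RATE CORRECTIONS —
each order's solvability in the rotation-cokernel direction is met by the rate, which is where `RateSelection1AL` is consumed —
then re-winding of the ends at the frame rate `α⁰+β` and the forced window `g(β)·Z_β`).** -/
def FamilyDressing1AL : Prop :=
  RateSelection1AL → DefectFamily1AL

/-- **Conclusion of stub S2b** — around EVERY re-wound defect family with sufficiently narrow window `q₁ ≥ q₀` and sufficiently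
high order `k ≥ k₀` (size `Cs`) there is a defect-bordered frozen-rate gate (spec `DefectGateSpec1AG`) with exponent `κ` and
constant `C₂` depending on the box constants and `Cs` only — not on `Γ`, the skeleton, the family, `q₁` or `k`. -/
def DefectGate1AL : Prop :=
  ∀ (N : ℕ) (δ ρ K Λ a b cnd η Rw Rb cg θ₀ KA : ℝ), 0 < N → 0 < δ → 0 < ρ → 0 ≤ a → 0 < η → 0 < Rw → 0 < Rb → 0 < cg → 0 < θ₀ →
    ∀ Cs : ℝ, ∃ κ C₂ q₀ : ℝ, ∃ k₀ : ℕ, ∀ q₁ : ℝ, q₀ ≤ q₁ → ∀ k : ℕ, k₀ ≤ k → 1 ≤ k → ∀ Cr : ℝ, ∃ Γ₁ : ℝ, ∀ Γ : ℝ, Γ₁ ≤ Γ → ∀ (γ : Fin N → ℝ) (α : ℝ) (X : Fin N → ℝ → EuclideanSpace ℝ (Fin 3)) (w : Fin N → ℝ → ℝ) (c : Fin N → ℝ) (m n : Fin N → EuclideanSpace ℝ (Fin 3)) (Aa : Fin N → ℝ → ℝ) (u : (Fin N → ℝ → EuclideanSpace ℝ (Fin 3)) → EuclideanSpace ℝ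 (Fin 3) → EuclideanSpace ℝ (Fin 3)) (v : EuclideanSpace ℝ (Fin 3) → EuclideanSpace ℝ (Fin 3)) (A : Fin N → (EuclideanSpace ℝ (Fin 3) →L[ℝ] EuclideanSpace ℝ (Fin 3))) (T : (Fin N → ℝ → EuclideanSpace ℝ (Fin 3)) → Fin N → ℝ → EuclideanSpace ℝ (Fin 3)),
      DefU1 N Γ γ Aa u → DefV1 N α X u v → DefA1 N X c v A → DefT1 N α u T → Clauses1L N Γ δ ρ K Λ a b cnd Rw Rb cg θ₀ KA γ α X w c m n Aa v A T →
      ∀ (α0 β₀ : ℝ) (U0 : ℝ → EuclideanSpace ℝ (Fin 3) → EuclideanSpace ℝ (Fin 3)) (P0 : ℝ → EuclideanSpace ℝ (Fin 3) → ℝ) (Z : ℝ → EuclideanSpace ℝ (Fin 3) → EuclideanSpace ℝ (Fin 3)) (g : ℝ → ℝ) (r : ℝ → EuclideanSpace ℝ (Fin 3) → EuclideanSpace ℝ (Fin 3)),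
        FamilySpec1AG N Γ ρ η Rw Rb θ₀ k Cs Cr q₁ α X u α0 β₀ U0 P0 Z g r →
      ∃ (𝓚 : ℝ → (EuclideanSpace ℝ (Fin 3) → EuclideanSpace ℝ (Fin 3)) → EuclideanSpace ℝ (Fin 3) → EuclideanSpace ℝ (Fin 3)) (𝓠 : ℝ → (EuclideanSpace ℝ (Fin 3) → EuclideanSpace ℝ (Fin 3)) → EuclideanSpace ℝ (Fin 3) → ℝ) (𝓫 : ℝ → (EuclideanSpace ℝ (Fin 3) → EuclideanSpace ℝ (Fin 3)) → ℝ),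
        DefectGateSpec1AG Γ κ C₂ β₀ α0 U0 Z 𝓚 𝓠 𝓫

/-- **Statement of stub S3 · `DefectClosing1AL` (size L; frozen-rate contraction at each `β` + CONTINUITY in `β` + the
intermediate-value theorem on the scalar defect).**  Given the size `Cs`, the gate's `κ, C₂` and ANY thresholds `q₀, k₀`, SOME
window exponent `q₁ ≥ q₀` and order `k ≥ k₀` (`k > κ + q₁ + 6`) suffice: for every family of that order and every defect gate around it, for `Γ ≥ Γ₁`, at each `|β| ≤ β₀` the map
`G ↦ −r_β − D(𝓚_β G)[𝓚_β G]` has a fixed point `G_β` in a Y-ball of radius `2Cr Γ^(−k)`, `β ↦ b_β := 𝓫_β G_β` is continuous with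
`|b_β| < Γ^(−q₁)`, so `g(β*) + b_(β*) = 0` for some `β*` in the window; then `α₁ = α⁰ + β* ≠ 0`, `U = U⁰_(β*) + 𝓚 G`, `P = P⁰ + 𝓠 G`
satisfy the crux's conclusion with `C²/C¹` regularity (`U ≠ 0` from the non-degeneracy point `y₀`). -/
def DefectClosing1AL : Prop :=
  ∀ (N : ℕ) (δ ρ K Λ a b cnd η Rw Rb cg θ₀ KA : ℝ), 0 < N → 0 < δ → 0 < ρ → 0 ≤ a → 0 < η → 0 < Rw → 0 < Rb → 0 < cg → 0 < θ₀ →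
    ∀ Cs κ C₂ q₀ : ℝ, ∀ k₀ : ℕ, ∃ q₁ : ℝ, q₀ ≤ q₁ ∧ ∃ k : ℕ, k₀ ≤ k ∧ 1 ≤ k ∧ ∀ Cr : ℝ, ∃ Γ₁ : ℝ, ∀ Γ : ℝ, Γ₁ ≤ Γ → ∀ (γ : Fin N → ℝ) (α : ℝ) (X : Fin N → ℝ → EuclideanSpace ℝ (Fin 3)) (w : Fin N → ℝ → ℝ) (c : Fin N → ℝ) (m n : Fin N → EuclideanSpace ℝ (Fin 3)) (Aa : Fin N → ℝ → ℝ) (u : (Fin N → ℝ → EuclideanSpace ℝ (Fin 3)) → EuclideanSpace ℝ (Fin 3) → EuclideanSpace ℝ (Fin 3)) (v : EuclideanSpace ℝ (Fin 3) → EuclideanSpace ℝ (Fin 3)) (A : Fin N → (EuclideanSpace ℝ (Fin 3) →L[ℝ] EuclideanSpace ℝ (Fin 3))) (T : (Fin N → ℝ → EuclideanSpace ℝ (Fin 3)) → Fin N → ℝ → EuclideanSpace ℝ (Fin 3)),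
      DefU1 N Γ γ Aa u → DefV1 N α X u v → DefA1 N X c v A → DefT1 N α u T → Clauses1L N Γ δ ρ K Λ a b cnd Rw Rb cg θ₀ KA γ α X w c m n Aa v A T →
      ∀ (α0 β₀ : ℝ) (U0 : ℝ → EuclideanSpace ℝ (Fin 3) → EuclideanSpace ℝ (Fin 3)) (P0 : ℝ → EuclideanSpace ℝ (Fin 3) → ℝ) (Z : ℝ → EuclideanSpace ℝ (Fin 3) → EuclideanSpace ℝ (Fin 3)) (g : ℝ → ℝ) (r : ℝ → EuclideanSpace ℝ (Fin 3) → EuclideanSpace ℝ (Fin 3)),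
        FamilySpec1AG N Γ ρ η Rw Rb θ₀ k Cs Cr q₁ α X u α0 β₀ U0 P0 Z g r →
      ∀ (𝓚 : ℝ → (EuclideanSpace ℝ (Fin 3) → EuclideanSpace ℝ (Fin 3)) → EuclideanSpace ℝ (Fin 3) → EuclideanSpace ℝ (Fin 3)) (𝓠 : ℝ → (EuclideanSpace ℝ (Fin 3) → EuclideanSpace ℝ (Fin 3)) → EuclideanSpace ℝ (Fin 3) → ℝ) (𝓫 : ℝ → (EuclideanSpace ℝ (Fin 3) → EuclideanSpace ℝ (Fin 3)) → ℝ),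
        DefectGateSpec1AG Γ κ C₂ β₀ α0 U0 Z 𝓚 𝓠 𝓫 →
      ∃ (α₁ C₀ M : ℝ) (U : EuclideanSpace ℝ (Fin 3) → EuclideanSpace ℝ (Fin 3)) (P : EuclideanSpace ℝ (Fin 3) → ℝ), AlmostConcl1AG N Γ ρ η Rw X u α₁ C₀ M U P


/-- **Statement of stub S3a · `ClosingIVT1AL`**: `DefectContinuity1AG → DefectClosing1AL` (the analytic half of S3; S3b `DefectContinuity1AG` is
clause-free and already proved, p646054). -/
def ClosingIVT1AL : Prop :=
  DefectContinuity1AG → DefectClosing1AL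

/-- **Statement of stub S2b-loc · `GateAssemblyLoc1AL`**: patching the LOCALISED sectional gate (S2a-loc, clause-free, unchanged) and the rate
selection into the defect-bordered gate, for the L-twin. -/
def GateAssemblyLoc1AL : Prop :=
  RateSelection1AL → WaistColumnGateLoc1A → DefectGate1AL

end Summit.NavierStokesRegularity.NavierStokesRegularity.Theorems.DefectColumnGate

end
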